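import Summits.CriticalPhenomena.PercolationContinuityZ3.Theorems.PercNearOneGluingNoHeavyRsw3WMSFeqFMSF
import Literature.Probability.Percolation.SlabMSFStatement
import HarnessLib

/-!
# RSW3 lane (P1, gen 34): `WMSF = FMSF` ALMOST SURELY FROM UNIQUENESS AT EVERY FIXED LEVEL (Lyons–Peres–Schramm 2006,
# Prop. 3.6, by the one-edge disintegration), and the paper-literal form of NTW 2017 Thm 2.4 on the slabs `S_k`

builds on p205010 (kernel theorem, internal audit signed; external expert review pending) — NOT used in this file (the import of
`…Rsw3WMSFeqFMSF` is for its deterministic §1 only: `wmsf_subset_fmsf`, `infinite_ltCluster_of_mem_fmsf_of_not_mem_wmsf`).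

Cell `prim-rsw3`, prover seat `prim-rsw3-p1` (gen 34), build-out blueprint `prim-rsw3-lead/gen44/BUILDOUT-PLAN.md` §6 (F10, the
`_thm24_free` form) of the sequel NTW 2017 Thm 2.4.  Support file (`--supports stmt-CriticalPhenomena-4575`); no definitions, no named
facts, no sorries.

Lyons–Peres–Schramm (Ann. Probab. 34 (2006), Prop. 3.6): on any connected locally finite graph, `F_w = F_f` a.s. iff for Lebesgue-a.e.
`p` Bernoulli(`p`) percolation has a.s. at most one infinite cluster.  The tree's `ℤ^d` file (`…Rsw3WMSFeqFMSF`, p2) goes through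
SIMULTANEOUS uniqueness of the standard coupling (which needs the invasion theory and, at the critical level, p205010).  Here the "if"
direction is proved DIRECTLY from uniqueness at every FIXED level `p ∈ (0,1)` by the one-edge disintegration: a bond `e = [u,v] ∈ 𝔉_f ∖ 𝔉_w`
has its endpoints in two distinct infinite clusters of the strict configuration `{U < U(e)}` (`infinite_ltCluster_of_mem_fmsf_of_not_mem_wmsf`);
writing the label measure as the product of the law of `U(e)` and of the other labels (`Measure.eq_infinitePi`), the section of this event
at `U(e) = c` is, up to the null event "some other label equals `c`", the event that `η_c` computed with `e` CLOSED has two infinite clusters —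
and almost every level `c' > c` of `U(e)` closes `e` at level `c`, so uniqueness of `η_c` a.s. kills every section (Fubini,
`Measure.prod_apply`).

* `measurableSet_ltDistinctInfinite` — measurability of the event `A(e)`;
* **`labelMeasure_ltDistinctInfinite_eq_zero`** — `μ(A(e)) = 0` for every pair `e` and all `u, v`, on any locally finite graph with
  countably many vertices whose Bernoulli percolation has a.s. at most one infinite cluster at every `p ∈ (0,1)`;
* **`ae_wmsf_eq_fmsf_of_ae_uniqueness`** — hence `𝔉_w(U) = 𝔉_f(U)` a.s. on such a graph (LPS06 Prop. 3.6, "if");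
* `ae_wmsf_eq_fmsf_zd` — `ℤ^d` for EVERY `d`, continuity-free (uniqueness: `Grimmett1999_numInfiniteClusters_le_one_holds`);
* `ae_wmsf_eq_fmsf_slab` — the slabs `S_k` (uniqueness: `ae_numInfiniteClusters_slab_le_one`, Burton–Keane);
* **`NewmanTassionWu2017.thm24_free_of_thm24`** — `NewmanTassionWu2017_thm24 → NewmanTassionWu2017_thm24_free` (the paper-literal form of
  Theorem 2.4: "the minimal spanning forest", free = wired, is a single tree).

References: R. Lyons, Y. Peres, O. Schramm, *Minimal spanning forests*, Ann. Probab. 34 (2006), Prop. 3.6 [LyonsPeresSchramm2006];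
R. Lyons, Y. Peres, *Probability on Trees and Networks* (2016), Prop. 11.7 [LyonsPeres2016]; C. M. Newman, V. Tassion, W. Wu, CPAM 70
(2017), Thm 2.4 and §2.1 ("on S_k, WMSF and FMSF coincide") [NewmanTassionWu2017]; R. M. Burton, M. Keane, CMP 121 (1989) [BurtonKeane1989].
-/

noncomputable section

open MeasureTheory Filter Set
open Literature.Probability.Percolation Literature.Barriers.CriticalPhenomena

namespace Summit.CriticalPhenomena.PercolationContinuityZ3.Theorems.Rsw3

section General

variable {V : Type*} [DecidableEq V] [Countable V] (G : SimpleGraph V) [G.LocallyFinite]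

omit [DecidableEq V] [G.LocallyFinite] in
/-- The event `A(e₀; u, v)` — "in the strict configuration `{g ∈ E : U g < U e₀}` the clusters of `u` and `v` are infinite and
distinct" — is measurable. [cite: LyonsPeres2016, Prop. 11.7 (proof: the event A(e))] -/
theorem measurableSet_ltDistinctInfinite (e₀ : Sym2 V) (u v : V) :
    MeasurableSet {U : Sym2 V → ℝ |
      (openCluster {g | g ∈ G.edgeSet ∧ U g < U e₀} u).Infinite ∧
      (openCluster {g | g ∈ G.edgeSet ∧ U g < U e₀} v).Infinite ∧
      ¬ (openGraph {g | g ∈ G.edgeSet ∧ U g < U e₀}).Reachable u v} := by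
  have hκ : Measurable fun U : Sym2 V → ℝ => ({g | g ∈ G.edgeSet ∧ U g < U e₀} : BondConfig V) := by
    refine measurable_set_iff.2 fun g => ?_
    simp only [Set.mem_setOf_eq]
    exact measurable_const.and
      (measurableSet_setOf.1 (measurableSet_lt (measurable_pi_apply g) (measurable_pi_apply e₀)))
  have hS : MeasurableSet {ω : BondConfig V | ω ∈ percolatesAt u ∧ ω ∈ percolatesAt v ∧ ω ∉ openConn u v} :=
    (measurableSet_percolatesAt_holds u).inter
      ((measurableSet_percolatesAt_holds v).inter (measurableSet_openConn_holds u v).compl)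
  exact hS.preimage hκ

omit [G.LocallyFinite] in
/-- **The one-edge disintegration (LPS06 Prop. 3.6, "if" direction, for one bond).** On a locally finite graph with countably many
vertices whose Bernoulli(`p`) percolation has a.s. at most one infinite cluster for every `p ∈ (0,1)`: for every pair `e₀` and all
`u, v`, almost surely the clusters of `u` and `v` in the strict configuration `{g ∈ E : U g < U e₀}` are NOT two distinct infinite
clusters. [cite: LyonsPeresSchramm2006, Prop. 3.6] [cite: LyonsPeres2016, Prop. 11.7] -/
theorem labelMeasure_ltDistinctInfinite_eq_zero
    (huniq : ∀ p : unitInterval, 0 < (p : ℝ) → (p : ℝ) < 1 →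
      ∀ᵐ ω ∂(bondPercolation G p), numInfiniteClusters ω ≤ 1)
    (e₀ : Sym2 V) (u v : V) :
    labelMeasure V {U : Sym2 V → ℝ |
      (openCluster {g | g ∈ G.edgeSet ∧ U g < U e₀} u).Infinite ∧
      (openCluster {g | g ∈ G.edgeSet ∧ U g < U e₀} v).Infinite ∧
      ¬ (openGraph {g | g ∈ G.edgeSet ∧ U g < U e₀}).Reachable u v} = 0 := by
  classical
  set A := {U : Sym2 V → ℝ |
      (openCluster {g | g ∈ G.edgeSet ∧ U g < U e₀} u).Infinite ∧
      (openCluster {g | g ∈ G.edgeSet ∧ U g < U e₀} v).Infinite ∧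
      ¬ (openGraph {g | g ∈ G.edgeSet ∧ U g < U e₀}).Reachable u v} with hA
  have hAm : MeasurableSet A := measurableSet_ltDistinctInfinite G e₀ u v
  -- the law of one label, and the product of the other labels
  set vol' : Measure ℝ := (volume : Measure ℝ).restrict (Icc (0 : ℝ) 1) with hvol'
  haveI : IsProbabilityMeasure vol' := isProbabilityMeasure_volume_restrict_unitInterval
  set πJ : Measure ({g : Sym2 V // g ≠ e₀} → ℝ) := Measure.infinitePi (fun _ : {g : Sym2 V // g ≠ e₀} => vol')
    with hπJ
  -- gluing a value at `e₀` with a field of the other labels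
  set glue : ℝ × ({g : Sym2 V // g ≠ e₀} → ℝ) → (Sym2 V → ℝ) :=
    fun q g => if h : g = e₀ then q.1 else q.2 ⟨g, h⟩ with hglue
  have hglue_e₀ : ∀ q, glue q e₀ = q.1 := fun q => by simp [hglue]
  have hglue_ne : ∀ q (g : Sym2 V) (h : g ≠ e₀), glue q g = q.2 ⟨g, h⟩ := fun q g h => by simp [hglue, h]
  have hmglue : Measurable glue := by
    refine measurable_pi_lambda _ fun g => ?_
    by_cases h : g = e₀
    · simp only [hglue, h, dif_pos]
      exact measurable_fst
    · simp only [hglue, h, dif_neg, not_false_eq_true]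
      exact (measurable_pi_apply _).comp measurable_snd
  -- the product decomposition of the label measure along the coordinate `e₀`
  have hmap : (vol'.prod πJ).map glue = labelMeasure V := by
    rw [labelMeasure]
    refine Measure.eq_infinitePi _ fun s t ht => ?_
    rw [Measure.map_apply hmglue (MeasurableSet.pi s.countable_toSet fun i _ => ht i)]
    have hpre : glue ⁻¹' Set.pi (↑s) t =
        (if e₀ ∈ s then t e₀ else univ) ×ˢ
          Set.pi (↑(s.subtype fun g => g ≠ e₀)) (fun i : {g : Sym2 V // g ≠ e₀} => t i) := by
      ext q
      obtain ⟨c, w⟩ := q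
      simp only [Set.mem_preimage, Set.mem_pi, Finset.mem_coe, Set.mem_prod, Finset.mem_subtype]
      constructor
      · intro h
        refine ⟨?_, fun i hi => ?_⟩
        · split_ifs with he
          · have := h e₀ he
            rwa [hglue_e₀] at this
          · exact Set.mem_univ _
        · have := h i hi
          rwa [hglue_ne (c, w) i i.2] at this
      · rintro ⟨hc, hw⟩ g hg
        by_cases h : g = e₀
        · subst h
          rw [if_pos hg] at hc
          rwa [hglue_e₀]
        · rw [hglue_ne (c, w) g h]
          exact hw ⟨g, h⟩ hg
    rw [hpre, Measure.prod_prod, hπJ,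
      Measure.infinitePi_pi (fun _ : {g : Sym2 V // g ≠ e₀} => vol') (s := s.subtype fun g => g ≠ e₀)
        (t := fun i : {g : Sym2 V // g ≠ e₀} => t i) (fun i _ => ht i),
      Finset.prod_subtype_eq_prod_filter (fun g : Sym2 V => vol' (t g)), Finset.filter_ne']
    by_cases he : e₀ ∈ s
    · rw [if_pos he, Finset.mul_prod_erase s (fun g => vol' (t g)) he]
    · rw [if_neg he, measure_univ, one_mul, Finset.erase_eq_of_notMem he]
  -- uniqueness at a fixed level, transported to the product space
  have hN : ∀ c : ℝ, 0 < c → c < 1 → ∀ᵐ q ∂(vol'.prod πJ),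
      numInfiniteClusters (configOfLabels c (glue q) G) ≤ 1 := by
    intro c hc0 hc1
    have h1 : ∀ᵐ U ∂(labelMeasure V), numInfiniteClusters (configOfLabels c U G) ≤ 1 := by
      have hmapc := map_configOfLabels_holds G ⟨c, hc0.le, hc1.le⟩
      have h := huniq ⟨c, hc0.le, hc1.le⟩ hc0 hc1
      rw [← hmapc] at h
      exact ae_of_ae_map (measurable_configOfLabels c G).aemeasurable h
    rw [← hmap] at h1
    exact ae_of_ae_map hmglue.aemeasurable h1
  -- every section at a level `c ∈ (0,1)` is null
  have hsec : ∀ c : ℝ, 0 < c → c < 1 → πJ (Prod.mk c ⁻¹' (glue ⁻¹' A)) = 0 := by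
    intro c hc0 hc1
    -- a good level `c' > c` of the label of `e₀` (it closes `e₀` at level `c`)
    obtain ⟨c', hcc', hgood⟩ : ∃ c', c < c' ∧
        ∀ᵐ w ∂πJ, numInfiniteClusters (configOfLabels c (glue (c', w)) G) ≤ 1 := by
      have hae := Measure.ae_ae_of_ae_prod (hN c hc0 hc1)
      by_contra hcon
      have hsub : Ioi c ⊆ {c' | ¬ ∀ᵐ w ∂πJ, numInfiniteClusters (configOfLabels c (glue (c', w)) G) ≤ 1} :=
        fun c' hc' hP => hcon ⟨c', hc', hP⟩
      have h0 : vol' (Ioi c) = 0 := measure_mono_null hsub (ae_iff.1 hae)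
      have hpos : 0 < vol' (Ioi c) := by
        rw [hvol', Measure.restrict_apply measurableSet_Ioi]
        have hIoo : Ioo c 1 ⊆ Ioi c ∩ Icc 0 1 := fun x hx => ⟨hx.1, (hc0.trans hx.1).le, hx.2.le⟩
        refine lt_of_lt_of_le ?_ (measure_mono hIoo)
        rw [Real.volume_Ioo]
        exact ENNReal.ofReal_pos.2 (by linarith)
      exact hpos.ne' h0
    -- the two null sets containing the section
    have hbad1 : πJ {w | ¬ numInfiniteClusters (configOfLabels c (glue (c', w)) G) ≤ 1} = 0 := ae_iff.1 hgood
    have hbad2 : πJ {w : {g : Sym2 V // g ≠ e₀} → ℝ | ∃ g, w g = c} = 0 := by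
      have hU : {w : {g : Sym2 V // g ≠ e₀} → ℝ | ∃ g, w g = c} =
          ⋃ g : {g : Sym2 V // g ≠ e₀}, Function.eval g ⁻¹' {c} := by
        ext w; simp
      rw [hU]
      refine measure_iUnion_null fun g => ?_
      rw [(measurePreserving_eval_infinitePi (fun _ : {g : Sym2 V // g ≠ e₀} => vol') g).measure_preimage
        (measurableSet_singleton c).nullMeasurableSet]
      exact le_antisymm ((Measure.restrict_apply_le _ _).trans Real.volume_singleton.le) bot_le
    refine measure_mono_null (fun w hw => ?_) (measure_union_null hbad1 hbad2)
    by_cases h2 : ∃ g : {g : Sym2 V // g ≠ e₀}, w g = c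
    · exact Or.inr h2
    · left
      have h2' : ∀ g : {g : Sym2 V // g ≠ e₀}, w g ≠ c := fun g hg => h2 ⟨g, hg⟩
      intro hle1
      -- at the glued field `(c, w)` the strict configuration below `U e₀ = c` is `η_c` of the field `(c', w)`
      have hκ : ({g | g ∈ G.edgeSet ∧ glue (c, w) g < glue (c, w) e₀} : BondConfig V) =
          configOfLabels c (glue (c', w)) G := by
        ext g
        simp only [Set.mem_setOf_eq, configOfLabels, hglue_e₀]
        by_cases hg : g = e₀
        · subst hg
          rw [hglue_e₀, hglue_e₀]
          constructor
          · rintro ⟨_, h⟩; exact absurd h (lt_irrefl _)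
          · rintro ⟨_, h⟩; exact absurd h (not_le.2 hcc')
        · rw [hglue_ne (c, w) g hg, hglue_ne (c', w) g hg]
          exact ⟨fun ⟨hE, hlt⟩ => ⟨hE, hlt.le⟩, fun ⟨hE, hle⟩ => ⟨hE, lt_of_le_of_ne hle (h2' ⟨g, hg⟩)⟩⟩
      have hw' : glue (c, w) ∈ A := hw
      rw [hA, Set.mem_setOf_eq, hκ] at hw'
      obtain ⟨hu, hv, hne⟩ := hw'
      exact hne (reachable_of_numInfiniteClusters_le_one hle1 hu hv)
  -- Fubini
  have hprod : (vol'.prod πJ) (glue ⁻¹' A) = 0 := by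
    rw [Measure.prod_apply (hAm.preimage hmglue)]
    have hnull : ∀ x : ℝ, vol' {x} = 0 := fun x =>
      le_antisymm ((Measure.restrict_apply_le _ _).trans Real.volume_singleton.le) bot_le
    have h01 : ∀ᵐ c ∂vol', 0 < c ∧ c < 1 := by
      have hIcc : ∀ᵐ c ∂vol', c ∈ Icc (0 : ℝ) 1 := ae_restrict_mem measurableSet_Icc
      have h0 : ∀ᵐ c ∂vol', c ≠ 0 := by
        rw [ae_iff]
        simp only [not_not, setOf_eq_eq_singleton]
        exact hnull 0
      have h1 : ∀ᵐ c ∂vol', c ≠ 1 := by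
        rw [ae_iff]
        simp only [not_not, setOf_eq_eq_singleton]
        exact hnull 1
      filter_upwards [hIcc, h0, h1] with c hc hc0 hc1
      exact ⟨lt_of_le_of_ne hc.1 (Ne.symm hc0), lt_of_le_of_ne hc.2 hc1⟩
    refine (lintegral_congr_ae (h01.mono fun c hc => ?_)).trans lintegral_zero
    exact hsec c hc.1 hc.2
  rw [← hmap, Measure.map_apply hmglue hAm]
  exact hprod

/-- **`WMSF = FMSF` ALMOST SURELY, FROM UNIQUENESS AT EVERY FIXED LEVEL** (Lyons–Peres–Schramm 2006 Prop. 3.6, "if"): on a locally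
finite graph with countably many vertices whose Bernoulli(`p`) bond percolation has a.s. at most one infinite cluster for every
`p ∈ (0,1)`, the wired and free minimal spanning forests of the uniformly labelled graph coincide almost surely.
[cite: LyonsPeresSchramm2006, Prop. 3.6] [cite: LyonsPeres2016, Prop. 11.7] -/
theorem ae_wmsf_eq_fmsf_of_ae_uniqueness
    (huniq : ∀ p : unitInterval, 0 < (p : ℝ) → (p : ℝ) < 1 →
      ∀ᵐ ω ∂(bondPercolation G p), numInfiniteClusters ω ≤ 1) :
    ∀ᵐ U ∂(labelMeasure V), wmsf G U = fmsf G.edgeSet U := by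
  have hA : ∀ᵐ U ∂(labelMeasure V), ∀ u v : V, U ∉ {U : Sym2 V → ℝ |
      (openCluster {g | g ∈ G.edgeSet ∧ U g < U s(u, v)} u).Infinite ∧
      (openCluster {g | g ∈ G.edgeSet ∧ U g < U s(u, v)} v).Infinite ∧
      ¬ (openGraph {g | g ∈ G.edgeSet ∧ U g < U s(u, v)}).Reachable u v} := by
    refine ae_all_iff.2 fun u => ae_all_iff.2 fun v => ?_
    exact measure_eq_zero_iff_ae_notMem.1 (labelMeasure_ltDistinctInfinite_eq_zero G huniq s(u, v) u v)
  filter_upwards [hA, ae_injective_labelMeasure (V := V)] with U hU hinj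
  refine Subset.antisymm (wmsf_subset_fmsf U) fun e he => ?_
  induction e using Sym2.ind with
  | h u v =>
    by_contra hnot
    exact hU u v (infinite_ltCluster_of_mem_fmsf_of_not_mem_wmsf hinj he hnot)

end General

/-- **`WMSF = FMSF` a.s. on `ℤ^d`, EVERY `d`, continuity-free**: from uniqueness at every fixed level (Grimmett Thm (8.1),
`Grimmett1999_numInfiniteClusters_le_one_holds`) — the tree's `ae_wmsf_eq_fmsf` (p2, `d ≥ 2`) went through simultaneous uniqueness and
used p205010 at the critical level; this route needs neither. [cite: LyonsPeresSchramm2006, Prop. 3.6] [cite: LyonsPeres2016, Prop. 11.7 and Exercise 11.8 (c)] -/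
theorem ae_wmsf_eq_fmsf_zd (d : ℕ) :
    ∀ᵐ U ∂(labelMeasure (Literature.Probability.LatticeModels.Site d)),
      wmsf (Literature.Probability.LatticeModels.zdGraph d) U = fmsf (Literature.Probability.LatticeModels.zdGraph d).edgeSet U :=
  ae_wmsf_eq_fmsf_of_ae_uniqueness (Literature.Probability.LatticeModels.zdGraph d) fun p _ _ =>
    Grimmett1999_numInfiniteClusters_le_one_holds d p

end Summit.CriticalPhenomena.PercolationContinuityZ3.Theorems.Rsw3

namespace Summit.CriticalPhenomena.PercolationContinuityZ3.Theorems.Crossing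

/-- **On every slab `S_k` the wired and free minimal spanning forests coincide a.s.** (uniqueness of the infinite cluster on `S_k` at
every `p > 0`: `ae_numInfiniteClusters_slab_le_one`, Burton–Keane). [cite: NewmanTassionWu2017, §2.1 ("It follows from [AKN] and [BK] that the infinite cluster on S_k, if it exists, is a.s. unique. Therefore on S_k, WMSF and FMSF coincide")] -/
theorem ae_wmsf_eq_fmsf_slab (k : ℕ) :
    ∀ᵐ U ∂(labelMeasure (slab 3 k)), wmsf (slabGraph 3 k) U = fmsf (slabGraph 3 k).edgeSet U :=
  Rsw3.ae_wmsf_eq_fmsf_of_ae_uniqueness (slabGraph 3 k) fun _ hp _ => ae_numInfiniteClusters_slab_le_one k hp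

/-- **NTW 2017 Thm 2.4, paper-literal form, from the WMSF form**: `NewmanTassionWu2017_thm24 → NewmanTassionWu2017_thm24_free`
(a.s. `𝔉_w = 𝔉_f` on `S_k` and `𝔉_w` is a single tree). [cite: NewmanTassionWu2017, Theorem 2.4 (with §2.1, Prop. 2.2)] -/
theorem NewmanTassionWu2017.thm24_free_of_thm24 (h : NewmanTassionWu2017_thm24) : NewmanTassionWu2017_thm24_free := by
  intro k hk
  filter_upwards [ae_wmsf_eq_fmsf_slab k, h k hk] with U h1 h2
  exact ⟨h1, h2⟩

end Summit.CriticalPhenomena.PercolationContinuityZ3.Theorems.Crossing
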